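import Summits.RiemannHypothesis.RiemannHypothesis.Theorems.PfPersistenceM2Thermometer
import Literature.NumberTheory.LFunctions.DeBruijnNewmanProofs
import Literature.NumberTheory.LFunctions.DeBruijnPhiDecreasing
import HarnessLib

/-!
# PfPersistence (barrier-typer, gen 14) — pf's EDGE-GAIN LAW (PF-C12) typed, and its STRENGTH

Cell `pub-rhpf` (RH Perron–Frobenius persistence).  HONEST FRAMING: long-odds MECHANISM SEARCH; no RH
claims.  Everything below is RH-free and kernel-checked; the laws are HYPOTHESES (Props parametrised by
level / kernel functions), asserted for NO instance; pf's numbers (`κ_k`, the pre-registered predictions of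
PF.md §18.4) are DATA / DERIVED and appear here only in docstrings.

pf's candidate PF-C12 (INVARIANT-CANDIDATES.md, 2026-08-19T22:40Z; PF.md §18.4): with `Φ` = Riemann's kernel
in the window variable, `Φ(a) = 2 Σ_{n ≥ 1} (2π²n⁴e^{9a/2} − 3πn²e^{5a/2}) e^{−πn²e^{2a}}` (PF.md §16.10; in tree
terms `Φ(a) = 2 · deBruijnPhi (a/2)`), and `λ(a) := −Φ′(a)/Φ(a) = 2πe^{2a} − 9/2 − O(e^{−2a})`, the residual
`R₀(a) := log ε₁⁺(a) − 2 log Φ(a) + λ(a)` is FLAT in the served windows (DATA: `R₀·lg e = 2.358 / 2.379 /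
2.357` at `a = 2.0 / 2.1 / 2.2`), i.e. `ε₁⁺(a) ≃ 10^{κ₀} Φ(a)² e^{−λ(a)}`.  Typed form requested by pf:
`EdgeGainLaw κ := Tendsto (fun a ↦ log (ε₁⁺ a) − 2 log (Φ a) + λ a) atTop (𝓝 κ)` over opaque `ε₁⁺, Φ, λ`,
plus the weaker two-sided `∀ᶠ` register version.

What this file records (all [folklore]-grade real analysis on top of tree theorems):

* §1 the typed objects, PARAMETRISED by three functions `ε Φ lam : ℝ → ℝ` (nothing asserted):
  `edgeGainResidual`, `edgeBudget` (`λ − 2 log Φ`), `EdgeGainLaw ε Φ lam κ`, the register forms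
  `EdgeGainBound` (two-sided `∀ᶠ`) and `EdgeGainUpper` (one-sided `∀ᶠ`), with unfolding lemmas.
* §2 the law is SIGN-BLIND (`Real.log = log |·|`): the residual of `ε`, of `|ε|` and of `−ε` coincide;
  `Law ⇒ Bound ⇒ Upper`.
* §3 STRENGTH (the typer's finding): as soon as the EDGE BUDGET diverges, `λ(a) − 2 log Φ(a) → +∞`, already the
  ONE-SIDED register form forces `ε(a) → 0` (`EdgeGainUpper.tendsto_zero`).  For the intended level
  `ε = ε_ev = weilEvenGroundEnergy` this is the Riemann hypothesis by the tree's thermometer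
  `PfPersistenceM2.riemannHypothesis_of_tendsto_weilEvenGroundEnergy` (CCM Cor. 3.8, even sector; RH-free: off
  RH `ε_ev ≤ −η < 0` on all large windows, `PolarPerronFrobenius.weilEvenGroundEnergy_le_neg_of_not_…`):
  `riemannHypothesis_of_edgeGainUpper`, `…_of_edgeGainBound`, `…_of_edgeGainLaw`.  So PF-C12 — even sign-blind,
  even one-sided, with ANY constant — is RH-STRENGTH: it implies RH, and it is not known to follow from RH (it
  asserts in addition the precise rate `log ε_ev(a) = −4πe^{2a} + O(a)`; the tree's RH-free UPPER bound is
  `ε_ev(a) ≤ e^{−c e^{2a}}`, `c < π`, `weilEvenGroundEnergy_le_exp_neg_mul_exp`).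
* §4 the intended kernel instance `riemannKernel a = 2 · deBruijnPhi (a/2)`, its edge rate
  `riemannEdgeRate = −Φ′/Φ` (via the tree's `hasDerivAt_deBruijnPhi`), `0 ≤ riemannEdgeRate a` for `a > 0`
  (`deBruijnPhiDeriv_neg_of_pos`), `log Φ(a) ≤ c + 9a/2 − πe^{2a}` (`deBruijnPhi_le_exp_holds`), hence the
  budget DOES diverge for Riemann's kernel (`tendsto_edgeBudget_riemannKernel`) and
  `riemannHypothesis_of_edgeGainLaw_riemannKernel` etc. discharge §3's budget hypothesis: the concrete PF-C12,
  as typed, implies RH.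
* Companion file `PfPersistenceTowerLawStrength.lean` (same seat, same day): the CORRECTION OF RECORD on PF-C9 —
  the sign-blind TOWER LOG LAW `log (ε_od/ε_ev)(a) ~ 4a` (typed in `PfPersistenceTowerLaw.lean`) implies RH as
  well, RH-free, by the a-priori size `|ε_od(a)| ≤ K(1+a)eᵃ`; bare `TowerDominance` (no rate) stays undecided.

𝒞-reading (MEMBERSHIP.md verdict V26): the per-window reading `R₀(a)` is (spectral tier: `log ε₁⁺(a)`) plus a
WINDOW-ONLY function of `a` (`λ(a) − 2 log Φ(a)`, no arithmetic input) — a member of `𝒞`, so L1 ⇒ W1 for any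
global separation claim at finitely many windows; the LAW is an E1-door statement (asymptotic in the window) whose
existence formulation is DECIDED here: RH-strength.

References (bib keys of `lean/references.bib`): `ConnesConsaniMoscovici2025` (arXiv:2511.22755) Cor. 3.8, §7
(Riemann's kernel as `k_∞`, eq. (7.6), Lemma 7.3); `Bombieri2000Weil` §4 (a-priori lower bound, Thm. 5
monotonicity); `RodgersTao2020` eq. (2) (the kernel `Φ`); `Titchmarsh1986` §10.1.
-/

noncomputable section

set_option linter.dupNamespace false  -- the mandated namespace repeats `RiemannHypothesis`

open Set Filter Asymptotics
open scoped Real Topology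

namespace Summit.RiemannHypothesis.RiemannHypothesis.Theorems.PfPersistence

open Literature.NumberTheory.LFunctions

variable {ε Φ lam : ℝ → ℝ} {κ C : ℝ}

/-! ## §1 The typed objects (parametrised by the level `ε`, the kernel `Φ` and the rate `lam`) -/

/-- TYPED (pf PF-C12): the EDGE-GAIN RESIDUAL `R(a) := log ε(a) − 2 log Φ(a) + λ(a)` of a level function `ε`
against a kernel `Φ` and a rate `λ` (natural logarithms; Mathlib's `Real.log` is `log |·|` with `log 0 = 0`). -/
def edgeGainResidual (ε Φ lam : ℝ → ℝ) (a : ℝ) : ℝ := Real.log (ε a) - 2 * Real.log (Φ a) + lam a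

/-- TYPED: the EDGE BUDGET `B(a) := λ(a) − 2 log Φ(a)` of the pair `(Φ, λ)` — a WINDOW-ONLY quantity (for
Riemann's kernel `≈ 4πe^{2a} − 9a`, §4). -/
def edgeBudget (Φ lam : ℝ → ℝ) (a : ℝ) : ℝ := lam a - 2 * Real.log (Φ a)

/-- TYPED (pf PF-C12, the form pf requested; a HYPOTHESIS on `(ε, Φ, λ)`, asserted for no triple): the
EDGE-GAIN LAW with constant `κ` — `log ε(a) − 2 log Φ(a) + λ(a) → κ` as `a → ∞` (pf's DATA for `ζ`:
`κ₀·lg e ≈ 2.36`, N-extrapolated `≈ 2.27`). -/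
def EdgeGainLaw (ε Φ lam : ℝ → ℝ) (κ : ℝ) : Prop := Tendsto (edgeGainResidual ε Φ lam) atTop (𝓝 κ)

/-- TYPED (pf PF-C12, register form; a HYPOTHESIS): two-sided eventual bound `|R(a)| ≤ C` for all large `a`. -/
def EdgeGainBound (ε Φ lam : ℝ → ℝ) (C : ℝ) : Prop := ∀ᶠ a in atTop, |edgeGainResidual ε Φ lam a| ≤ C

/-- TYPED (the weakest, ONE-SIDED register form; a HYPOTHESIS): `R(a) ≤ C` for all large `a`, i.e.
`log ε(a) ≤ 2 log Φ(a) − λ(a) + C` — "the level gains at least the edge budget". -/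
def EdgeGainUpper (ε Φ lam : ℝ → ℝ) (C : ℝ) : Prop := ∀ᶠ a in atTop, edgeGainResidual ε Φ lam a ≤ C

/-- PROVED (unfolding). [folklore] -/
theorem edgeGainResidual_def (a : ℝ) :
    edgeGainResidual ε Φ lam a = Real.log (ε a) - 2 * Real.log (Φ a) + lam a := rfl

/-- PROVED (unfolding). [folklore] -/
theorem edgeBudget_def (a : ℝ) : edgeBudget Φ lam a = lam a - 2 * Real.log (Φ a) := rfl

/-- PROVED: the residual is `log ε` PLUS the budget. [folklore] -/
theorem edgeGainResidual_eq_log_add_edgeBudget (a : ℝ) :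
    edgeGainResidual ε Φ lam a = Real.log (ε a) + edgeBudget Φ lam a := by
  rw [edgeGainResidual_def, edgeBudget_def]; ring

/-- PROVED (unfolding). [folklore] -/
theorem edgeGainLaw_iff : EdgeGainLaw ε Φ lam κ ↔ Tendsto (edgeGainResidual ε Φ lam) atTop (𝓝 κ) := Iff.rfl

/-- PROVED (unfolding). [folklore] -/
theorem edgeGainBound_iff : EdgeGainBound ε Φ lam C ↔ ∀ᶠ a in atTop, |edgeGainResidual ε Φ lam a| ≤ C :=
  Iff.rfl

/-- PROVED (unfolding): the one-sided form says `log ε(a) ≤ C − B(a)` eventually. [folklore] -/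
theorem edgeGainUpper_iff :
    EdgeGainUpper ε Φ lam C ↔ ∀ᶠ a in atTop, Real.log (ε a) ≤ C - edgeBudget Φ lam a := by
  simp only [EdgeGainUpper, edgeGainResidual_eq_log_add_edgeBudget]
  exact eventually_congr (Eventually.of_forall fun a => by constructor <;> intro h <;> linarith)

/-! ## §2 Sign-blindness; Law ⇒ Bound ⇒ Upper -/

/-- PROVED: the residual is SIGN-BLIND — `|ε|` has the same residual as `ε` (`Real.log |x| = Real.log x`).
[folklore] -/
theorem edgeGainResidual_abs : edgeGainResidual (fun a => |ε a|) Φ lam = edgeGainResidual ε Φ lam := by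
  funext a; simp only [edgeGainResidual, Real.log_abs]

/-- PROVED: `−ε` has the same residual as `ε`. [folklore] -/
theorem edgeGainResidual_neg : edgeGainResidual (fun a => -ε a) Φ lam = edgeGainResidual ε Φ lam := by
  funext a; simp only [edgeGainResidual, Real.log_neg_eq_log]

/-- PROVED: the law for `ε` is literally the law for `|ε|`. [folklore] -/
theorem edgeGainLaw_abs_iff : EdgeGainLaw (fun a => |ε a|) Φ lam κ ↔ EdgeGainLaw ε Φ lam κ := by
  rw [EdgeGainLaw, EdgeGainLaw, edgeGainResidual_abs]

/-- PROVED: the law for `ε` is literally the law for `−ε` (it cannot see the sign of the level). [folklore] -/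
theorem edgeGainLaw_neg_iff : EdgeGainLaw (fun a => -ε a) Φ lam κ ↔ EdgeGainLaw ε Φ lam κ := by
  rw [EdgeGainLaw, EdgeGainLaw, edgeGainResidual_neg]

/-- PROVED: the one-sided register form for `ε` is literally the one for `|ε|`. [folklore] -/
theorem edgeGainUpper_abs_iff : EdgeGainUpper (fun a => |ε a|) Φ lam C ↔ EdgeGainUpper ε Φ lam C := by
  rw [EdgeGainUpper, EdgeGainUpper, edgeGainResidual_abs]

/-- PROVED: the law implies the two-sided register form with constant `|κ| + 1`. [folklore] -/
theorem EdgeGainLaw.edgeGainBound (h : EdgeGainLaw ε Φ lam κ) : EdgeGainBound ε Φ lam (|κ| + 1) := by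
  have hev : ∀ᶠ a in atTop, dist (edgeGainResidual ε Φ lam a) κ < 1 :=
    (Metric.tendsto_nhds.1 h) 1 one_pos
  filter_upwards [hev] with a ha
  rw [Real.dist_eq] at ha
  have h1 := abs_sub_abs_le_abs_sub (edgeGainResidual ε Φ lam a) κ
  linarith

/-- PROVED: the two-sided register form implies the one-sided one. [folklore] -/
theorem EdgeGainBound.edgeGainUpper (h : EdgeGainBound ε Φ lam C) : EdgeGainUpper ε Φ lam C :=
  h.mono fun _ ha => (le_abs_self _).trans ha

/-- PROVED: the law implies the one-sided register form. [folklore] -/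
theorem EdgeGainLaw.edgeGainUpper (h : EdgeGainLaw ε Φ lam κ) : EdgeGainUpper ε Φ lam (|κ| + 1) :=
  h.edgeGainBound.edgeGainUpper

/-! ## §3 STRENGTH: a divergent edge budget plus the one-sided law forces `ε → 0` (hence RH for `ε_ev`) -/

/-- PROVED (the typer's finding, abstract form): if the edge budget diverges, `λ(a) − 2 log Φ(a) → +∞`, then
the ONE-SIDED register form `log ε(a) ≤ 2 log Φ(a) − λ(a) + C` (eventually) forces `ε(a) → 0`.  (Where
`ε(a) = 0` the junk value `log 0 = 0` makes the hypothesis fail for large `a`, and `|ε(a)| = 0` anyway.)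
[folklore] -/
theorem EdgeGainUpper.tendsto_zero (h : EdgeGainUpper ε Φ lam C)
    (hB : Tendsto (edgeBudget Φ lam) atTop atTop) : Tendsto ε atTop (𝓝 0) := by
  rw [Metric.tendsto_nhds]
  intro δ hδ
  have hB' : ∀ᶠ a in atTop, C - Real.log δ < edgeBudget Φ lam a := hB.eventually_gt_atTop _
  filter_upwards [edgeGainUpper_iff.1 h, hB'] with a ha hb
  rw [Real.dist_0_eq_abs]
  have hlog : Real.log (ε a) < Real.log δ := by linarith
  rcases eq_or_ne (ε a) 0 with h0 | h0
  · rwa [h0, abs_zero]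
  · rw [← Real.log_abs] at hlog
    exact (Real.log_lt_log_iff (abs_pos.2 h0) hδ).1 hlog

/-- PROVED: the two-sided register form with a divergent budget forces `ε → 0`. [folklore] -/
theorem EdgeGainBound.tendsto_zero (h : EdgeGainBound ε Φ lam C)
    (hB : Tendsto (edgeBudget Φ lam) atTop atTop) : Tendsto ε atTop (𝓝 0) :=
  h.edgeGainUpper.tendsto_zero hB

/-- PROVED: the edge-gain law with a divergent budget forces `ε → 0`. [folklore] -/
theorem EdgeGainLaw.tendsto_zero (h : EdgeGainLaw ε Φ lam κ)
    (hB : Tendsto (edgeBudget Φ lam) atTop atTop) : Tendsto ε atTop (𝓝 0) :=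
  h.edgeGainUpper.tendsto_zero hB

/-- PROVED (RH-STRENGTH of the one-sided register form for the even sector): for ANY kernel / rate pair
with divergent edge budget, `EdgeGainUpper weilEvenGroundEnergy Φ lam C` implies the Riemann hypothesis —
RH-free, via the tree thermometer `lim ε_ev = 0 ⇒ RH`. [folklore] -/
theorem riemannHypothesis_of_edgeGainUpper (hB : Tendsto (edgeBudget Φ lam) atTop atTop)
    (h : EdgeGainUpper weilEvenGroundEnergy Φ lam C) : RiemannHypothesis :=
  PfPersistenceM2.riemannHypothesis_of_tendsto_weilEvenGroundEnergy (h.tendsto_zero hB)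

/-- PROVED (RH-strength of the two-sided register form). [folklore] -/
theorem riemannHypothesis_of_edgeGainBound (hB : Tendsto (edgeBudget Φ lam) atTop atTop)
    (h : EdgeGainBound weilEvenGroundEnergy Φ lam C) : RiemannHypothesis :=
  riemannHypothesis_of_edgeGainUpper hB h.edgeGainUpper

/-- PROVED (RH-strength of pf's PF-C12 in the abstract): the edge-gain law for `ε_ev` against any pair
`(Φ, λ)` with divergent budget, with ANY constant `κ`, implies RH. [folklore] -/
theorem riemannHypothesis_of_edgeGainLaw (hB : Tendsto (edgeBudget Φ lam) atTop atTop)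
    (h : EdgeGainLaw weilEvenGroundEnergy Φ lam κ) : RiemannHypothesis :=
  riemannHypothesis_of_edgeGainUpper hB h.edgeGainUpper

/-- PROVED (the same for the full bottom `ε = weilGroundEnergy ≤ ε_ev`): `ε → 0 ⇒ RH`, so the one-sided law
for `ε` with divergent budget implies RH as well. [folklore] -/
theorem riemannHypothesis_of_edgeGainUpper_ground (hB : Tendsto (edgeBudget Φ lam) atTop atTop)
    (h : EdgeGainUpper weilGroundEnergy Φ lam C) : RiemannHypothesis := by
  have h0 : Tendsto weilGroundEnergy atTop (𝓝 0) := h.tendsto_zero hB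
  refine PfPersistenceM2.riemannHypothesis_of_groundEnergy_floor (a := fun k : ℕ => (k : ℝ))
    (σ := fun k : ℕ => |weilGroundEnergy k|) tendsto_natCast_atTop_atTop ?_
    (Eventually.of_forall fun k => neg_abs_le _)
  simpa using (h0.comp tendsto_natCast_atTop_atTop).abs

/-! ## §4 The intended kernel: Riemann's `Φ` in the window variable, its edge rate, and the budget -/

/-- TYPED (the INTENDED KERNEL of PF-C12; PF.md §16.10): Riemann's kernel in the window variable,
`Φ(a) = 2 Σ_{n ≥ 1} (2π²n⁴e^{9a/2} − 3πn²e^{5a/2}) e^{−πn²e^{2a}} = 2 · deBruijnPhi (a/2)` (cosine transform `= Ξ`). -/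
def riemannKernel (a : ℝ) : ℝ := 2 * deBruijnPhi (a / 2)

/-- TYPED (pf's `λ(a) := −Φ′(a)/Φ(a)`, the EDGE LOG-DERIVATIVE RATE of Riemann's kernel; pf's DATA/asymptotics:
`= 2πe^{2a} − 9/2 − O(e^{−2a})`). -/
def riemannEdgeRate (a : ℝ) : ℝ := -deriv riemannKernel a / riemannKernel a

/-- PROVED (unfolding). [folklore] -/
theorem riemannKernel_def (a : ℝ) : riemannKernel a = 2 * deBruijnPhi (a / 2) := rfl

/-- PROVED: `Φ(a) > 0` for `a ≥ 0` (tree: `deBruijnPhi_pos_of_nonneg`). [folklore] -/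
theorem riemannKernel_pos {a : ℝ} (ha : 0 ≤ a) : 0 < riemannKernel a :=
  mul_pos two_pos (deBruijnPhi_pos_of_nonneg (by linarith))

/-- PROVED: `Φ′(a) = deBruijnPhi′(a/2)` (chain rule on the tree's `hasDerivAt_deBruijnPhi`). [folklore] -/
theorem hasDerivAt_riemannKernel (a : ℝ) : HasDerivAt riemannKernel (deBruijnPhiDeriv (a / 2)) a := by
  have h2 : HasDerivAt (fun x : ℝ => x / 2) (1 / 2) a := by
    simpa using (hasDerivAt_id a).div_const (2 : ℝ)
  have h := ((hasDerivAt_deBruijnPhi (a / 2)).comp a h2).const_mul (2 : ℝ)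
  have e : 2 * (deBruijnPhiDeriv (a / 2) * (1 / 2)) = deBruijnPhiDeriv (a / 2) := by ring
  rw [e] at h
  exact h

/-- PROVED: `deriv Φ (a) = deBruijnPhi′(a/2)`. [folklore] -/
theorem deriv_riemannKernel (a : ℝ) : deriv riemannKernel a = deBruijnPhiDeriv (a / 2) :=
  (hasDerivAt_riemannKernel a).deriv

/-- PROVED: closed form of the rate, `λ(a) = −deBruijnPhi′(a/2) / (2 deBruijnPhi(a/2))`. [folklore] -/
theorem riemannEdgeRate_eq (a : ℝ) :
    riemannEdgeRate a = -deBruijnPhiDeriv (a / 2) / (2 * deBruijnPhi (a / 2)) := by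
  rw [riemannEdgeRate, deriv_riemannKernel, riemannKernel_def]

/-- PROVED: `λ(a) ≥ 0` for `a > 0` — Riemann's kernel DECREASES on `(0, ∞)` (tree: `deBruijnPhiDeriv_neg_of_pos`,
Pustyl'nikov). [folklore] -/
theorem riemannEdgeRate_nonneg {a : ℝ} (ha : 0 < a) : 0 ≤ riemannEdgeRate a := by
  rw [riemannEdgeRate_eq]
  have h1 : deBruijnPhiDeriv (a / 2) < 0 := deBruijnPhiDeriv_neg_of_pos (by linarith)
  have h2 : 0 < 2 * deBruijnPhi (a / 2) := mul_pos two_pos (deBruijnPhi_pos_of_nonneg (by linarith))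
  exact div_nonneg (by linarith) h2.le

/-- PROVED: `log Φ(a) ≤ c + (9/2)a − πe^{2a}` for `a ≥ 0` (tree: `deBruijnPhi_le_exp_holds`,
`Φ_dB(u) ≤ C e^{9u − πe^{4u}}`). [folklore] -/
theorem log_riemannKernel_le :
    ∃ c : ℝ, ∀ a : ℝ, 0 ≤ a → Real.log (riemannKernel a) ≤ c + 9 / 2 * a - π * Real.exp (2 * a) := by
  obtain ⟨C, hC⟩ := deBruijnPhi_le_exp_holds
  -- `C > 0`, since `0 < Φ_dB(0) ≤ C e^{…}`
  have hC0 : 0 < C := by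
    have h := hC 0 le_rfl
    have hp := deBruijnPhi_pos_of_nonneg (le_refl (0 : ℝ))
    by_contra hle
    have : C * Real.exp (9 * 0 - π * Real.exp (4 * 0)) ≤ 0 :=
      mul_nonpos_of_nonpos_of_nonneg (not_lt.1 hle) (Real.exp_pos _).le
    linarith
  refine ⟨Real.log (2 * C), fun a ha => ?_⟩
  have hu : 0 ≤ a / 2 := by linarith
  have hΦ := deBruijnPhi_pos_of_nonneg hu
  have hle : riemannKernel a ≤ 2 * C * Real.exp (9 * (a / 2) - π * Real.exp (4 * (a / 2))) := by
    rw [riemannKernel_def]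
    have := hC (a / 2) hu
    nlinarith
  have hpos : 0 < 2 * C * Real.exp (9 * (a / 2) - π * Real.exp (4 * (a / 2))) := by positivity
  calc Real.log (riemannKernel a)
      ≤ Real.log (2 * C * Real.exp (9 * (a / 2) - π * Real.exp (4 * (a / 2)))) :=
        Real.log_le_log (riemannKernel_pos ha) hle
    _ = Real.log (2 * C) + (9 * (a / 2) - π * Real.exp (4 * (a / 2))) := by
        rw [Real.log_mul (by positivity) (Real.exp_pos _).ne', Real.log_exp]
    _ = Real.log (2 * C) + 9 / 2 * a - π * Real.exp (2 * a) := by ring_nf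

/-- PROVED: for Riemann's kernel the EDGE BUDGET DIVERGES, `λ(a) − 2 log Φ(a) → +∞` (indeed
`≥ 2πe^{2a} − 9a − 2c ≥ (4π − 9)a + 2π − 2c`). [folklore] -/
theorem tendsto_edgeBudget_riemannKernel : Tendsto (edgeBudget riemannKernel riemannEdgeRate) atTop atTop := by
  obtain ⟨c, hc⟩ := log_riemannKernel_le
  have hlin : Tendsto (fun a : ℝ => (4 * π - 9) * a + (2 * π - 2 * c)) atTop atTop :=
    tendsto_atTop_add_const_right _ _
      (tendsto_id.const_mul_atTop (by linarith [Real.pi_gt_three] : (0 : ℝ) < 4 * π - 9))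
  refine tendsto_atTop_mono' atTop ?_ hlin
  filter_upwards [eventually_gt_atTop (0 : ℝ)] with a ha
  have h1 := hc a ha.le
  have h2 := riemannEdgeRate_nonneg ha
  have h3 : 2 * a + 1 ≤ Real.exp (2 * a) := Real.add_one_le_exp _
  rw [edgeBudget_def]
  nlinarith [Real.pi_pos]

/-- PROVED (RH-STRENGTH OF pf's PF-C12 AS TYPED, concrete kernel): the edge-gain law of the even sector
bottom against Riemann's kernel and its edge rate, with ANY constant `κ`, implies the Riemann hypothesis
(RH-free).  Nothing here says the law holds for `ζ`; RH is not known to imply it. [folklore] -/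
theorem riemannHypothesis_of_edgeGainLaw_riemannKernel
    (h : EdgeGainLaw weilEvenGroundEnergy riemannKernel riemannEdgeRate κ) : RiemannHypothesis :=
  riemannHypothesis_of_edgeGainLaw tendsto_edgeBudget_riemannKernel h

/-- PROVED: the two-sided register form of PF-C12 (concrete kernel, any constant) implies RH. [folklore] -/
theorem riemannHypothesis_of_edgeGainBound_riemannKernel
    (h : EdgeGainBound weilEvenGroundEnergy riemannKernel riemannEdgeRate C) : RiemannHypothesis :=
  riemannHypothesis_of_edgeGainBound tendsto_edgeBudget_riemannKernel h

/-- PROVED: already the ONE-SIDED register form `log ε_ev(a) ≤ 2 log Φ(a) − λ(a) + C` (eventually; concrete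
kernel, any constant) implies RH. [folklore] -/
theorem riemannHypothesis_of_edgeGainUpper_riemannKernel
    (h : EdgeGainUpper weilEvenGroundEnergy riemannKernel riemannEdgeRate C) : RiemannHypothesis :=
  riemannHypothesis_of_edgeGainUpper tendsto_edgeBudget_riemannKernel h

end Summit.RiemannHypothesis.RiemannHypothesis.Theorems.PfPersistence

end
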